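import Summits.AtomisticToContinuum.BoseEinsteinCondensation.Theses.BECSectorPoincareTwoScale
import Literature.MathematicalPhysics.QuantumManyBody.PeriodicBoseGasMomentumSector
import Literature.MathematicalPhysics.QuantumManyBody.PeriodicBoseGasScattering
import Literature.MathematicalPhysics.QuantumManyBody.BoseGasThermodynamicLimitRuelle
import Literature.MathematicalPhysics.QuantumManyBody.BoseGasDirichletWall
import HarnessLib

/-!
# Route `BECSectorPoincareTwoScale` — support item `LandauFloorToSectorGap` (stmt-AtomisticToContinuum-9096)

The route decl `LandauFloorToSectorGap`, proved as stated (the glue at the junction with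
route `BECNoCheapMomentum`): for each admissible `v`,

  `EnergyConvexityWindow`'s body for `v` → `LandauSectorBound`'s body for `v` → `∫ v(|x|) dx ≠ 0` →
  `∀ C > 0 ∃ κ, ρ₀ > 0 ∀ ρ ∈ (0, ρ₀) ∀ᶠ N ∀ k ≠ 0, ‖k‖² ≤ Cρ →`
  `2E₀^per(N, L_N) + 2κ‖k‖² ≤ E^per_{N+1}(k; L_N) + E^per_{N-1}(k; L_N)`,

`L_N = (N/ρ)^{1/3}` (`sideLength`), the sector energies being the infima of `periodicEnergy` over the
Bloch-`k` periodic trial states — definitionally `momentumSectorEnergy` (`momentumSectorEnergy_eq_iInf`,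
`rfl`). This is the per-potential twin, with the quadratic floor, of the accepted stub
`Cruxes.PeriodicIRBound.LinearPhFloorWagner.stub_linearFloor_of_landau`
(`Theorems/BECGroundStateSOSPeriodicIRBoundLinearFloorOfLandau.lean`) composed with its pooling lemma
`sectorGapFloor_of_linearParticleHoleFloor`; the proof below follows those two verbatim.

Proof. Fix admissible `v` with `∫ v(|x|)dx ≠ 0` and `C > 0`.
* `a := scatteringLength v` is finite (finite range, `scatteringLength_ne_top_of_finiteRange`) and
  nonzero (`a = 0` forces `v(|·|) = 0` a.e., `LSSY2005_zeroScatteringLength_holds`, contradicting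
  `∫v ≠ 0`), so `0 < a.toReal`.
* Apply the Landau body with `M₀ := √(C/a)` (output `θ, ρ₀ᴸ`) and the convexity body with `ε := πθ`
  (output `ρ₁`); the constants are `κ := (3/4)θ√a/√C`, `ρ₀ := min ρ₀ᴸ ρ₁`.
* For `0 < ρ < ρ₀` pull the Landau eventual set back along `N ↦ N ± 1` and intersect with the
  convexity set at `N` and `N ≥ 2`; in the box `L = L_N`, `L³ = N/ρ`, the densities `ρ`,
  `ρ(N ± 1)/N` lie in `[ρ/2, 2ρ]`.
* Off the dual lattice `(2π/L)ℤ³` both sector energies are `⊤`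
  (`momentumSectorEnergy_eq_top_of_forall_ne`). For `k = 2πm/L`, `m ≠ 0`:
  `2π/L ≤ ‖k‖ ≤ √(Cρ) = M₀√(ρa)`, the Bloch condition `HasTotalMomentum k` is the one of the Landau
  body, so `E₀(N±1,L) + θ√(ρa)‖k‖ ≤ E_{N±1}(k;L)`; with `2E₀(N,L) ≤ E₀(N+1,L) + E₀(N-1,L) +
  πθ√(ρa)/L`, `2κ‖k‖² ≤ 2·(3/4)θ√a·√ρ‖k‖` (as `‖k‖ ≤ √C√ρ`) and
  `πθ√(ρa)/L + 2·(3/4)θ√a·√ρ‖k‖ ≤ 2θ√(ρa)‖k‖` (from `2π/L ≤ ‖k‖`) the floor follows by monotone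
  `ℝ≥0∞` bookkeeping (no subtraction).

No named facts are used (unconditional). References: LSSY2005 App. C (scattering length);
S. Stringari, in *Bose–Einstein Condensation* (CUP 1995) §2.2.
-/

noncomputable section

open scoped BigOperators ENNReal
open Filter MeasureTheory

namespace Summit.AtomisticToContinuum.BoseEinsteinCondensation.Theorems

open Literature.MathematicalPhysics.QuantumManyBody.BoseGas
open Summit.AtomisticToContinuum.BoseEinsteinCondensation.Theses.BECSectorPoincareTwoScale
  (LandauFloorToSectorGap)

namespace LandauFloorToSectorGap

/-! ### Helper lemmas (adapted from `BECGroundStateSOSPeriodicIRBoundLinearFloorOfLandau.lean`) -/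

/-- The dual-lattice vector `latticeVec c m` is `c • m` with `m` viewed in `ℝ³`. [folklore] -/
theorem latticeVec_eq_smul (c : ℝ) (m : Fin 3 → ℤ) :
    latticeVec c m = c • (WithLp.toLp 2 fun t => (m t : ℝ) : EuclideanSpace ℝ (Fin 3)) := by
  ext i
  simp [latticeVec, PiLp.toLp_apply]

/-- `‖latticeVec c m‖ = c‖m‖` for `c ≥ 0`. [folklore] -/
theorem norm_latticeVec_of_nonneg {c : ℝ} (hc : 0 ≤ c) (m : Fin 3 → ℤ) :
    ‖latticeVec c m‖ = c * ‖(WithLp.toLp 2 fun t => (m t : ℝ) : EuclideanSpace ℝ (Fin 3))‖ := by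
  rw [latticeVec_eq_smul, norm_smul, Real.norm_of_nonneg hc]

/-- A nonzero integer vector has Euclidean norm at least `1`. [folklore] -/
theorem one_le_norm_toLp_intCast {m : Fin 3 → ℤ} (hm : m ≠ 0) :
    1 ≤ ‖(WithLp.toLp 2 fun t => (m t : ℝ) : EuclideanSpace ℝ (Fin 3))‖ := by
  obtain ⟨t, ht⟩ : ∃ t, m t ≠ 0 := by
    by_contra h
    push Not at h
    exact hm (funext h)
  have h1 : (1 : ℝ) ≤ |(m t : ℝ)| := by exact_mod_cast Int.one_le_abs ht
  calc (1 : ℝ) ≤ |(m t : ℝ)| := h1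
    _ = ‖(WithLp.toLp 2 fun t => (m t : ℝ) : EuclideanSpace ℝ (Fin 3)) t‖ := by
        rw [PiLp.toLp_apply, Real.norm_eq_abs]
    _ ≤ _ := PiLp.norm_apply_le _ t

/-- The Bloch sum of a dual-lattice momentum: `∑ⱼ (2πm/L)ⱼ sⱼ = (2π/L) ∑ⱼ mⱼ sⱼ`. [folklore] -/
theorem sum_latticeVec_mul (L : ℝ) (m : Fin 3 → ℤ) (s : EuclideanSpace ℝ (Fin 3)) :
    (∑ j, (latticeVec (2 * Real.pi / L) m) j * s j) =
      2 * Real.pi / L * ∑ t, (m t : ℝ) * s t := by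
  rw [Finset.mul_sum]
  exact Finset.sum_congr rfl fun t _ => by simp only [latticeVec, PiLp.toLp_apply]; ring

/-- A state of total momentum `2πm/L` (`HasTotalMomentum`) satisfies the Bloch condition in the
form quantified in `LandauSectorBound`. [folklore] -/
theorem bloch_of_hasTotalMomentum {M : ℕ} {L : ℝ} {m : Fin 3 → ℤ} {ψ : Config M → ℂ}
    (hψ : HasTotalMomentum (latticeVec (2 * Real.pi / L) m) ψ) :
    ∀ (X : Config M) (s : EuclideanSpace ℝ (Fin 3)),
      ψ (fun j => X j + s) =
        Complex.exp (Complex.I * ↑(2 * Real.pi / L * ∑ t : Fin 3, (m t : ℝ) * s t)) * ψ X := by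
  intro X s
  rw [hψ s X, sum_latticeVec_mul]

/-- Density windows at particle numbers `N`, `N + 1`, `N - 1` in the box `L³ = N/ρ`, `N ≥ 2`.
[folklore] -/
theorem density_windows {ρ L : ℝ} {N : ℕ} (hρ : 0 < ρ) (hN : 2 ≤ N)
    (hL3 : L ^ 3 = N / ρ) :
    (ρ / 2 ≤ (N : ℝ) / L ^ 3 ∧ (N : ℝ) / L ^ 3 ≤ 2 * ρ) ∧
    (ρ / 2 ≤ ((N + 1 : ℕ) : ℝ) / L ^ 3 ∧ ((N + 1 : ℕ) : ℝ) / L ^ 3 ≤ 2 * ρ) ∧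
    (ρ / 2 ≤ ((N - 1 : ℕ) : ℝ) / L ^ 3 ∧ ((N - 1 : ℕ) : ℝ) / L ^ 3 ≤ 2 * ρ) := by
  have hNr : (2 : ℝ) ≤ N := by exact_mod_cast hN
  have hN0 : (0 : ℝ) < N := by linarith
  have h1N : 1 ≤ N := by omega
  have hw : ∀ M : ℕ, (M : ℝ) / L ^ 3 = ρ * M / N := fun M => by
    rw [hL3, div_div_eq_mul_div, mul_comm]
  simp only [hw]
  push_cast [Nat.cast_sub h1N]
  refine ⟨⟨?_, ?_⟩, ⟨?_, ?_⟩, ⟨?_, ?_⟩⟩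
  · rw [le_div_iff₀ hN0]; nlinarith
  · rw [div_le_iff₀ hN0]; nlinarith
  · rw [le_div_iff₀ hN0]; nlinarith
  · rw [div_le_iff₀ hN0]; nlinarith
  · rw [le_div_iff₀ hN0]; nlinarith
  · rw [div_le_iff₀ hN0]; nlinarith

/-- On the window `‖k‖² ≤ Cρ` the quadratic floor with constant `θ'/√C` is dominated by the linear
floor with constant `θ'`: `2(θ'/√C)‖k‖² ≤ 2θ'√ρ‖k‖`. [folklore] -/
theorem quad_le_lin {θ' C ρ nk : ℝ} (hθ' : 0 ≤ θ') (hC : 0 < C) (hnk : 0 ≤ nk)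
    (hkC : nk ^ 2 ≤ C * ρ) :
    2 * (θ' / Real.sqrt C) * nk ^ 2 ≤ 2 * θ' * Real.sqrt ρ * nk := by
  have hCpos : 0 < Real.sqrt C := Real.sqrt_pos.2 hC
  have hk' : nk ≤ Real.sqrt C * Real.sqrt ρ := by
    rw [← Real.sqrt_mul hC.le, ← Real.sqrt_sq hnk]
    exact Real.sqrt_le_sqrt hkC
  calc 2 * (θ' / Real.sqrt C) * nk ^ 2
      = 2 * (θ' / Real.sqrt C) * nk * nk := by ring
    _ ≤ 2 * (θ' / Real.sqrt C) * (Real.sqrt C * Real.sqrt ρ) * nk := by gcongr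
    _ = 2 * θ' * Real.sqrt ρ * nk := by field_simp

/-- The real-arithmetic absorption of the convexity allowance `ε√(ρa)/L`, `ε = πθ`, by the Landau
floor, using `2π/L ≤ |k|`, with linear constant `θ' = (3/4)θ√a`. [folklore] -/
theorem real_absorb {θ ρ ar L nk : ℝ} (hθ : 0 ≤ θ) (hρ : 0 ≤ ρ) (hL : 0 < L)
    (hk : 2 * Real.pi / L ≤ nk) :
    Real.pi * θ * Real.sqrt (ρ * ar) / L + 2 * (3 / 4 * θ * Real.sqrt ar) * Real.sqrt ρ * nk ≤
      θ * Real.sqrt (ρ * ar) * nk + θ * Real.sqrt (ρ * ar) * nk := by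
  have hS : Real.sqrt (ρ * ar) = Real.sqrt ρ * Real.sqrt ar := Real.sqrt_mul hρ ar
  have h1 : Real.pi / L ≤ nk / 2 := by
    rw [div_le_iff₀ hL] at hk ⊢
    linarith
  calc Real.pi * θ * Real.sqrt (ρ * ar) / L + 2 * (3 / 4 * θ * Real.sqrt ar) * Real.sqrt ρ * nk
      = θ * Real.sqrt (ρ * ar) * (Real.pi / L) + 3 / 2 * (θ * Real.sqrt (ρ * ar) * nk) := by
        rw [hS]; ring
    _ ≤ θ * Real.sqrt (ρ * ar) * (nk / 2) + 3 / 2 * (θ * Real.sqrt (ρ * ar) * nk) := by gcongr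
    _ = θ * Real.sqrt (ρ * ar) * nk + θ * Real.sqrt (ρ * ar) * nk := by ring

/-- `ℝ≥0∞` bookkeeping of the assembly: convexity at `N`, the absorbed real inequality and the
two sector floors at `N ± 1` give the particle–hole floor, without subtraction. [folklore] -/
theorem assemble {E EP EM SP SM : ℝ≥0∞} {x y z : ℝ}
    (hconv : 2 * E ≤ EP + EM + ENNReal.ofReal x) (hreal : x + y ≤ z + z)
    (hP : EP + ENNReal.ofReal z ≤ SP) (hM : EM + ENNReal.ofReal z ≤ SM)
    (hx : 0 ≤ x) (hy : 0 ≤ y) (hz : 0 ≤ z) :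
    2 * E + ENNReal.ofReal y ≤ SP + SM := by
  calc 2 * E + ENNReal.ofReal y ≤ EP + EM + ENNReal.ofReal x + ENNReal.ofReal y :=
        add_le_add hconv le_rfl
    _ = EP + EM + ENNReal.ofReal (x + y) := by rw [ENNReal.ofReal_add hx hy, add_assoc]
    _ ≤ EP + EM + ENNReal.ofReal (z + z) := add_le_add le_rfl (ENNReal.ofReal_le_ofReal hreal)
    _ = (EP + ENNReal.ofReal z) + (EM + ENNReal.ofReal z) := by
        rw [ENNReal.ofReal_add hz hz]
        exact add_add_add_comm _ _ _ _
    _ ≤ SP + SM := add_le_add hP hM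

end LandauFloorToSectorGap

open LandauFloorToSectorGap in
/-- **Support item `LandauFloorToSectorGap` (stmt-AtomisticToContinuum-9096), as stated.** For an
admissible `v` with `∫v ≠ 0` the scattering length `a` is finite (finite range) and nonzero (`a = 0`
forces `v = 0` a.e., LSSY2005 App. C), so `M₀ := √(C/a)` is admissible in the Landau body; its floor at
particle numbers `N ± 1` in the box `L_N³ = N/ρ` (densities `ρ(N±1)/N ∈ [ρ/2, 2ρ]` for `N ≥ 2`), the
emptiness of the Bloch classes off the dual lattice, the convexity body at `N` with `ε := πθ`
(absorbed through `|k| ≥ 2π/L_N`) and `‖k‖ ≤ √C√ρ` on the window give the quadratic particle–hole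
floor with `κ = (3/4)θ√a/√C`. [folklore] -/
theorem landauFloorToSectorGap_proof : LandauFloorToSectorGap := by
  intro v hv hconv hlandau hv0 C hC
  -- Step 1: the scattering length is finite and nonzero
  obtain ⟨R₀, hR₀⟩ := hv.2
  have ha_top : scatteringLength v ≠ ⊤ := scatteringLength_ne_top_of_finiteRange hR₀
  have ha_ne : scatteringLength v ≠ 0 := by
    intro ha0
    apply hv0
    have hae : ∀ᵐ x : Space, v ‖x‖ = 0 :=
      LSSY2005_zeroScatteringLength_holds v R₀ hv.1 hR₀ ha0
    exact lintegral_eq_zero_of_ae_eq_zero hae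
  have har : 0 < (scatteringLength v).toReal := ENNReal.toReal_pos ha_ne ha_top
  -- Step 2: the constants
  obtain ⟨θ, hθ, ρL, hρL, HL⟩ :=
    hlandau (Real.sqrt (C / (scatteringLength v).toReal)) (Real.sqrt_pos.2 (div_pos hC har))
  obtain ⟨ρ₁, hρ₁, HC⟩ := hconv
  refine ⟨3 / 4 * θ * Real.sqrt (scatteringLength v).toReal / Real.sqrt C, by positivity,
    min ρL ρ₁, lt_min hρL hρ₁, fun ρ hρ hρ₀ => ?_⟩
  have hρL' : ρ < ρL := lt_of_lt_of_le hρ₀ (min_le_left _ _)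
  have hρ₁' : ρ < ρ₁ := lt_of_lt_of_le hρ₀ (min_le_right _ _)
  -- Step 3: the eventual sets, at particle numbers `N + 1`, `N - 1` (Landau) and `N` (convexity)
  filter_upwards [(tendsto_add_atTop_nat 1).eventually (HL ρ hρ hρL'),
    (tendsto_sub_atTop_nat 1).eventually (HL ρ hρ hρL'),
    HC (Real.pi * θ) (mul_pos Real.pi_pos hθ) ρ hρ hρ₁', eventually_ge_atTop 2]
    with N hNp hNm hNc hN2
  intro k hk hkC
  -- the inlined infima are `momentumSectorEnergy` (definitionally, `momentumSectorEnergy_eq_iInf`)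
  show 2 * periodicGroundStateEnergy v N (sideLength ρ N) + _ ≤
    momentumSectorEnergy v (N + 1) (sideLength ρ N) k +
      momentumSectorEnergy v (N - 1) (sideLength ρ N) k
  -- Step 4: the box
  have hN0 : 0 < N := by omega
  have hL : 0 < sideLength ρ N := sideLength_pos_of_pos hρ hN0
  have hL3 : sideLength ρ N ^ 3 = N / ρ := sideLength_pow_three hρ N
  set L := sideLength ρ N
  obtain ⟨⟨hw1, hw2⟩, ⟨hwP1, hwP2⟩, ⟨hwM1, hwM2⟩⟩ := density_windows hρ hN2 hL3
  -- Step 5: off the dual lattice both sectors are empty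
  by_cases hlat : ∃ m : Fin 3 → ℤ, k = latticeVec (2 * Real.pi / L) m
  swap
  · push Not at hlat
    have h1 : momentumSectorEnergy v (N + 1) L k = ⊤ :=
      momentumSectorEnergy_eq_top_of_forall_ne hL v hlat
    rw [h1, top_add]
    exact le_top
  obtain ⟨m, rfl⟩ := hlat
  have hm : m ≠ 0 := by
    rintro rfl
    exact hk (latticeVec_zero _)
  -- norms
  have hc : 0 ≤ 2 * Real.pi / L := (div_pos Real.two_pi_pos hL).le
  have hnorm := norm_latticeVec_of_nonneg hc m
  have hklow : 2 * Real.pi / L ≤ ‖latticeVec (2 * Real.pi / L) m‖ := by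
    rw [hnorm]
    exact le_mul_of_one_le_right hc (one_le_norm_toLp_intCast hm)
  have hkM : 2 * Real.pi / L * ‖(WithLp.toLp 2 fun t => (m t : ℝ) : EuclideanSpace ℝ (Fin 3))‖ ≤
      Real.sqrt (C / (scatteringLength v).toReal) *
        Real.sqrt (ρ * (scatteringLength v).toReal) := by
    rw [← hnorm, ← Real.sqrt_mul (div_pos hC har).le,
      show C / (scatteringLength v).toReal * (ρ * (scatteringLength v).toReal) = C * ρ by
        field_simp,
      ← Real.sqrt_sq (norm_nonneg (latticeVec (2 * Real.pi / L) m))]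
    exact Real.sqrt_le_sqrt hkC
  -- the Landau floors at `N + 1` and `N - 1`
  have hP : periodicGroundStateEnergy v (N + 1) L +
        ENNReal.ofReal (θ * Real.sqrt (ρ * (scatteringLength v).toReal) *
          (2 * Real.pi / L * ‖(WithLp.toLp 2 fun t => (m t : ℝ) : EuclideanSpace ℝ (Fin 3))‖)) ≤
      momentumSectorEnergy v (N + 1) L (latticeVec (2 * Real.pi / L) m) :=
    le_momentumSectorEnergy_iff.2 fun Ψ hΨ =>
      hNp L hL hwP1 hwP2 m hm hkM Ψ (bloch_of_hasTotalMomentum hΨ)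
  have hM : periodicGroundStateEnergy v (N - 1) L +
        ENNReal.ofReal (θ * Real.sqrt (ρ * (scatteringLength v).toReal) *
          (2 * Real.pi / L * ‖(WithLp.toLp 2 fun t => (m t : ℝ) : EuclideanSpace ℝ (Fin 3))‖)) ≤
      momentumSectorEnergy v (N - 1) L (latticeVec (2 * Real.pi / L) m) :=
    le_momentumSectorEnergy_iff.2 fun Ψ hΨ =>
      hNm L hL hwM1 hwM2 m hm hkM Ψ (bloch_of_hasTotalMomentum hΨ)
  rw [← hnorm] at hP hM
  -- quadratic ≤ linear on the window, convexity at `N`, and assembly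
  have hquad := quad_le_lin (θ' := 3 / 4 * θ * Real.sqrt (scatteringLength v).toReal) (ρ := ρ)
    (by positivity) hC (norm_nonneg (latticeVec (2 * Real.pi / L) m)) hkC
  exact assemble (hNc L hL hw1 hw2)
    ((add_le_add le_rfl hquad).trans (real_absorb hθ.le hρ.le hL hklow)) hP hM (by positivity)
    (by positivity) (by positivity)

end Summit.AtomisticToContinuum.BoseEinsteinCondensation.Theorems

end
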